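import Mathlib

/-!
# Crux `RigidityForcesSymmetry.RigidMinimalRepr` (stmt-ValiantsHypothesis-4163), line `registered` —
# stub `stub_pencilLocInj` (Jacobi's formula + injective differential on a slice)

Route `ValiantsHypothesis/RigidityForcesSymmetry`, crux `RigidMinimalRepr`, skeleton
`Cruxes/RigidMinimalRepr/Lines/registered.lean` (lead's reshape v2), stub 2b.

**Statement.** Let `x₀ = (Λ, A)` be a pencil of size `m` over a finite variable type `ι`
(`x̃₀ = Λ + Σ_v x_v A_v`, coefficient space `X = M_m(ℂ) × (ι → M_m(ℂ))`) with `det x̃₀ = f ≠ 0`, assume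
INFINITESIMAL RIGIDITY (every `B = (Λ', A')` with `tr(adj(x̃₀)·B̃) = 0` in `ℂ[x]` is a gauge direction
`(PΛ − ΛQ, (PA_v − A_vQ)_v)`), and let `W ≤ X` be a linear subspace meeting the gauge tangent space
`T = {(PΛ + ΛQ, (PA_v + A_vQ)_v)}` only in `0`.  Then for `(c, w)` near `(1, 0)` with `w ∈ W`,
`det((x₀ + w)~) = c · f` forces `w = 0`.

**Proof.**  Evaluate at points `z ∈ ℂ^ι`: `D_z(B) = tr(adj(x̃₀(z)) B(z))` is a linear functional on `X`
and `eval_z (tr(adj(x̃₀) B̃)) = D_z(B)`; finitely many points `S` already cut out `⋂_z ker D_z`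
(descending chain condition in the finite-dimensional `X`), and we add a point `z₀` with `f(z₀) ≠ 0`.
The map `Ψ(c, w) = (det((x₀ + w)(z)) − c f(z))_{z ∈ S}` on `ℂ × W` has, by JACOBI'S FORMULA (the
determinant is a continuous multilinear map of the rows; `ContinuousMultilinearMap.hasFDerivAt`),
differential `(γ, w) ↦ (D_z(w) − γ f(z))_z` at `(1, 0)`, which is injective: `D_z(x₀) = m f(z)`, so
`D_z(w − (γ/m)x₀) = 0` on `S`, hence everywhere, hence `tr(adj(x̃₀)(w − (γ/m)x₀)~) = 0` in `ℂ[x]`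
(`MvPolynomial.funext`), hence `w − (γ/m)x₀ ∈ T` by infinitesimal rigidity, so `w ∈ T ∩ W = 0` and then
`γ f(z₀) = 0`.  An injective differential on a finite-dimensional space is bounded below
(`LinearMap.exists_antilipschitzWith`), which with `HasFDerivAt` gives local injectivity at `(1, 0)`;
finally `Ψ(c, w) = 0 = Ψ(1, 0)` whenever `det((x₀ + w)~) = c f`.
-/

noncomputable section

-- the mandated summit-side namespace repeats a component by design (single-problem summit)
set_option linter.dupNamespace false

namespace Summit.ValiantsHypothesis.ValiantsHypothesis.Theorems.RigidityForcesSymmetryRigidMinimalRepr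

open MvPolynomial Matrix Filter Topology
open scoped Matrix.Norms.Elementwise

/-! ### Jacobi's formula over `ℂ` -/

section Jacobi

variable {n : Type*} [Fintype n] [DecidableEq n]

/-- Laplace expansion along a replaced row: `det (M.updateRow i r) = Σ_j r_j adj(M)_{j i}`. -/
theorem det_updateRow_eq_sum (M : Matrix n n ℂ) (i : n) (r : n → ℂ) :
    (M.updateRow i r).det = ∑ j, r j * M.adjugate j i := by
  rw [det_eq_sum_mul_adjugate_row _ i]
  refine Finset.sum_congr rfl fun j _ => ?_
  rw [updateRow_self, adjugate_apply, updateRow_idem, ← adjugate_apply]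

/-- **Jacobi's formula** (Fréchet form over `ℂ`): if `A : E → M_n(ℂ)` has derivative `A'` at `y`, then
`e ↦ det A(e)` has derivative `v ↦ tr(adj(A y) · A' v)` at `y`. -/
theorem hasFDerivAt_det_of_hasFDerivAt {E : Type*} [NormedAddCommGroup E] [NormedSpace ℂ E]
    {A : E → Matrix n n ℂ} {A' : E →L[ℂ] Matrix n n ℂ} {y : E} (hA : HasFDerivAt A A' y) :
    ∃ D : E →L[ℂ] ℂ, HasFDerivAt (fun e => (A e).det) D y ∧
      ∀ v, D v = ((A y).adjugate * A' v).trace := by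
  -- the determinant as a continuous multilinear map of the rows (a polynomial in the entries)
  let Φ : ContinuousMultilinearMap ℂ (fun _ : n => n → ℂ) ℂ :=
    { toMultilinearMap := (Matrix.detRowAlternating : (n → ℂ) [⋀^n]→ₗ[ℂ] ℂ).toMultilinearMap
      cont := by
        change Continuous fun M : Matrix n n ℂ => M.det
        exact continuous_id.matrix_det }
  have hΦ : ∀ v : n → n → ℂ, Φ v = Matrix.det (Matrix.of v) := fun v => rfl
  have h : HasFDerivAt (fun e => (A e).det) ((Φ.linearDeriv (A y)).comp A') y :=
    (Φ.hasFDerivAt (A y)).comp y hA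
  refine ⟨_, h, fun v => ?_⟩
  rw [ContinuousLinearMap.comp_apply, ContinuousMultilinearMap.linearDeriv_apply, trace_mul_comm]
  simp only [hΦ, Matrix.trace, Matrix.diag, Matrix.mul_apply]
  refine Finset.sum_congr rfl fun i _ => ?_
  exact det_updateRow_eq_sum (A y) i (A' v i)

end Jacobi

/-! ### Two finite-dimensional lemmas -/

section FiniteDimensional

/-- An injective differential on a finite-dimensional space gives local injectivity at the point:
if `g` has derivative `L` at `a` with `ker L = 0`, then `g x = g a → x = a` for `x` near `a`. -/
theorem eventually_eq_of_hasFDerivAt_of_ker_eq_bot {E F : Type*} [NormedAddCommGroup E]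
    [NormedSpace ℂ E] [FiniteDimensional ℂ E] [NormedAddCommGroup F] [NormedSpace ℂ F]
    {g : E → F} {L : E →L[ℂ] F} {a : E} (hg : HasFDerivAt g L a)
    (hL : LinearMap.ker (L : E →ₗ[ℂ] F) = ⊥) : ∀ᶠ x in 𝓝 a, g x = g a → x = a := by
  obtain ⟨K, hK, hanti⟩ := LinearMap.exists_antilipschitzWith (L : E →ₗ[ℂ] F) hL
  have hε : (0 : ℝ) < 1 / (2 * K) := by positivity
  filter_upwards [hg.isLittleO.def hε] with x hx hgx
  rw [hgx, sub_self, zero_sub, norm_neg] at hx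
  have h1 : ‖x - a‖ ≤ K * ‖L (x - a)‖ := by
    have := hanti.le_mul_dist (x - a) 0
    simpa [dist_eq_norm] using this
  have h2 : ‖x - a‖ ≤ ‖x - a‖ / 2 :=
    calc ‖x - a‖ ≤ K * ‖L (x - a)‖ := h1
      _ ≤ K * (1 / (2 * K) * ‖x - a‖) := by gcongr
      _ = ‖x - a‖ / 2 := by field_simp
  have h3 : ‖x - a‖ ≤ 0 := by linarith [norm_nonneg (x - a)]
  exact sub_eq_zero.1 (norm_le_zero_iff.1 h3)

/-- In a finite-dimensional space, an arbitrary family of linear conditions is already imposed by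
finitely many of them (descending chain condition on submodules). -/
theorem exists_finset_forall_mem {α V : Type*} [AddCommGroup V] [Module ℂ V] [FiniteDimensional ℂ V]
    (K : α → Submodule ℂ V) : ∃ S : Finset α, ∀ x : V, (∀ a ∈ S, x ∈ K a) → ∀ a, x ∈ K a := by
  classical
  let F : Finset α → Submodule ℂ V := fun S => ⨅ a ∈ S, K a
  have hwf : WellFounded ((· < ·) : Submodule ℂ V → Submodule ℂ V → Prop) := wellFounded_lt
  obtain ⟨N, ⟨S, rfl⟩, hmin⟩ := hwf.has_min (Set.range F) ⟨F ∅, ∅, rfl⟩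
  refine ⟨S, fun x hx a => ?_⟩
  have hxS : x ∈ F S := by
    simp only [F, Submodule.mem_iInf]
    exact fun b hb => hx b hb
  have hle : F (insert a S) ≤ F S := by
    simp only [F]
    exact biInf_mono fun b hb => Finset.mem_insert_of_mem hb
  have heq : F (insert a S) = F S := by
    by_contra hne
    exact hmin (F (insert a S)) ⟨insert a S, rfl⟩ (lt_of_le_of_ne hle hne)
  have hx' : x ∈ F (insert a S) := heq ▸ hxS
  simp only [F, Submodule.mem_iInf] at hx'
  exact hx' a (Finset.mem_insert_self a S)

end FiniteDimensional

/-! ### Evaluating pencils at points -/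

section Pencil

variable {ι : Type} [Fintype ι] {m : ℕ}

/-- The pencil `Λ' + Σ_v x_v A'_v` evaluates at `z` to `Λ' + Σ_v z_v A'_v`. -/
theorem pencil_map_eval (z : ι → ℂ) (Λ' : Matrix (Fin m) (Fin m) ℂ) (A' : ι → Matrix (Fin m) (Fin m) ℂ) :
    (Λ'.map C + ∑ v, (X v : MvPolynomial ι ℂ) • (A' v).map C).map (eval z) = Λ' + ∑ v, z v • A' v := by
  ext i j
  simp [Matrix.sum_apply]

/-- `eval_z (det(Λ' + Σ x_v A'_v)) = det (Λ' + Σ z_v A'_v)`. -/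
theorem eval_det_pencil (z : ι → ℂ) (Λ' : Matrix (Fin m) (Fin m) ℂ) (A' : ι → Matrix (Fin m) (Fin m) ℂ) :
    eval z (Λ'.map C + ∑ v, (X v : MvPolynomial ι ℂ) • (A' v).map C).det = (Λ' + ∑ v, z v • A' v).det := by
  rw [RingHom.map_det, RingHom.mapMatrix_apply, pencil_map_eval]

/-- `eval_z (tr(adj(Λ̃) Λ̃')) = tr(adj(Λ + Σ z_v A_v) · (Λ' + Σ z_v A'_v))`. -/
theorem eval_trace_adj_pencil (z : ι → ℂ) (Λ : Matrix (Fin m) (Fin m) ℂ) (A : ι → Matrix (Fin m) (Fin m) ℂ)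
    (Λ' : Matrix (Fin m) (Fin m) ℂ) (A' : ι → Matrix (Fin m) (Fin m) ℂ) :
    eval z ((Λ.map C + ∑ v, (X v : MvPolynomial ι ℂ) • (A v).map C).adjugate *
        (Λ'.map C + ∑ v, (X v : MvPolynomial ι ℂ) • (A' v).map C)).trace =
      ((Λ + ∑ v, z v • A v).adjugate * (Λ' + ∑ v, z v • A' v)).trace := by
  rw [AddMonoidHom.map_trace, Matrix.map_mul, ← RingHom.mapMatrix_apply, RingHom.map_adjugate,
    RingHom.mapMatrix_apply, pencil_map_eval, pencil_map_eval]

end Pencil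

/-! ### The stub -/

section Main

/-- **Stub 2b (`stub_pencilLocInj`) of line `registered` for crux `RigidMinimalRepr`.**  Near `(1, 0)`, on a
linear slice `W` transverse to the gauge tangent space, `det((x₀ + w)~) = c · f` forces `w = 0`, given
infinitesimal rigidity of `x₀ = (Λ, A)` and `f ≠ 0` (Jacobi's formula + injective differential). -/
theorem stub_pencilLocInj :
    ∀ (ι : Type) [Fintype ι] (m : ℕ) (f : MvPolynomial ι ℂ) (Λ : Matrix (Fin m) (Fin m) ℂ) (A : ι → Matrix (Fin m) (Fin m) ℂ)
      (W : Submodule ℂ (Matrix (Fin m) (Fin m) ℂ × (ι → Matrix (Fin m) (Fin m) ℂ))),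
      f ≠ 0 →
      (Λ.map MvPolynomial.C + ∑ v, (MvPolynomial.X v : MvPolynomial ι ℂ) • (A v).map MvPolynomial.C).det = f →
      (∀ (Λ' : Matrix (Fin m) (Fin m) ℂ) (A' : ι → Matrix (Fin m) (Fin m) ℂ),
        ((Λ.map MvPolynomial.C + ∑ v, (MvPolynomial.X v : MvPolynomial ι ℂ) • (A v).map MvPolynomial.C).adjugate
            * (Λ'.map MvPolynomial.C + ∑ v, (MvPolynomial.X v : MvPolynomial ι ℂ) • (A' v).map MvPolynomial.C)).trace
          = (0 : MvPolynomial ι ℂ) →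
        ∃ P Q : Matrix (Fin m) (Fin m) ℂ, Λ' = P * Λ - Λ * Q ∧ ∀ v, A' v = P * A v - A v * Q) →
      (∀ (P Q : Matrix (Fin m) (Fin m) ℂ), ∀ w ∈ W,
        ((P * Λ + Λ * Q, fun v => P * A v + A v * Q) : Matrix (Fin m) (Fin m) ℂ × (ι → Matrix (Fin m) (Fin m) ℂ)) = w →
        w = 0) →
      ∃ N ∈ nhds ((1 : ℂ), (0 : Matrix (Fin m) (Fin m) ℂ × (ι → Matrix (Fin m) (Fin m) ℂ))),
        ∀ cw ∈ N, cw.2 ∈ W →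
          ((Λ + cw.2.1).map MvPolynomial.C +
              ∑ v, (MvPolynomial.X v : MvPolynomial ι ℂ) • (A v + cw.2.2 v).map MvPolynomial.C).det
            = MvPolynomial.C cw.1 * f →
          cw.2 = 0 := by
  intro ι _ m f Λ A W hf hdet hT hW
  classical
  -- (1) evaluation at points `z ∈ ℂ^ι` (a linear map `p ↦ p(z) = p.1 + Σ z_v p.2 v` on coefficient space)
  --     and the functionals `D_z(B) = tr(adj(x₀(z)) B(z))`
  let ev : (ι → ℂ) →
      ((Matrix (Fin m) (Fin m) ℂ × (ι → Matrix (Fin m) (Fin m) ℂ)) →ₗ[ℂ] Matrix (Fin m) (Fin m) ℂ) := fun z =>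
    LinearMap.fst ℂ _ _ + ∑ v, z v • ((LinearMap.proj v).comp (LinearMap.snd ℂ _ _))
  have hev : ∀ z (p : Matrix (Fin m) (Fin m) ℂ × (ι → Matrix (Fin m) (Fin m) ℂ)),
      ev z p = p.1 + ∑ v, z v • p.2 v := fun z p => by simp [ev]
  let Dz : (ι → ℂ) → ((Matrix (Fin m) (Fin m) ℂ × (ι → Matrix (Fin m) (Fin m) ℂ)) →ₗ[ℂ] ℂ) := fun z =>
    (Matrix.traceLinearMap (Fin m) ℂ ℂ) ∘ₗ (LinearMap.mulLeft ℂ (ev z (Λ, A)).adjugate) ∘ₗ ev z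
  have hDz' : ∀ z B, Dz z B = ((ev z (Λ, A)).adjugate * ev z B).trace := fun z B => rfl
  have hDz : ∀ z (B : Matrix (Fin m) (Fin m) ℂ × (ι → Matrix (Fin m) (Fin m) ℂ)),
      Dz z B = ((Λ + ∑ v, z v • A v).adjugate * (B.1 + ∑ v, z v • B.2 v)).trace := fun z B => by
    rw [hDz', hev, hev]
  have hdetz : ∀ z, (ev z (Λ, A)).det = eval z f := fun z => by
    rw [hev]
    exact (hdet ▸ eval_det_pencil z Λ A).symm
  have hDx₀ : ∀ z, Dz z (Λ, A) = (m : ℂ) * eval z f := fun z => by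
    rw [hDz', adjugate_mul, Matrix.trace_smul, trace_one, hdetz, Fintype.card_fin, smul_eq_mul, mul_comm]
  -- (2) finitely many points suffice, plus a point where `f ≠ 0`
  obtain ⟨S₀, hS₀⟩ := exists_finset_forall_mem fun z => LinearMap.ker (Dz z)
  obtain ⟨z₀, hz₀⟩ : ∃ z₀ : ι → ℂ, eval z₀ f ≠ 0 := by
    by_contra h
    exact hf (MvPolynomial.funext fun z => by
      rw [map_zero]
      exact not_not.1 (not_exists.1 h z))
  let S : Finset (ι → ℂ) := insert z₀ S₀
  -- (3) the key linear algebra: `D_z(w) = γ f(z)` on `S` with `w ∈ W` forces `w = 0`, `γ = 0`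
  have hkey : ∀ (γ : ℂ) (w : Matrix (Fin m) (Fin m) ℂ × (ι → Matrix (Fin m) (Fin m) ℂ)), w ∈ W →
      (∀ z ∈ S, Dz z w = γ * eval z f) → w = 0 ∧ γ = 0 := by
    intro γ w hw h
    have hw0 : w = 0 := by
      rcases Nat.eq_zero_or_pos m with hm | hm
      · subst hm
        exact Subsingleton.elim _ _
      · have hmC : (m : ℂ) ≠ 0 := Nat.cast_ne_zero.2 hm.ne'
        set B : Matrix (Fin m) (Fin m) ℂ × (ι → Matrix (Fin m) (Fin m) ℂ) :=
          w - (γ / m : ℂ) • ((Λ, A) : Matrix (Fin m) (Fin m) ℂ × (ι → Matrix (Fin m) (Fin m) ℂ)) with hB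
        have hBS : ∀ z ∈ S, Dz z B = 0 := by
          intro z hz
          rw [hB, map_sub, map_smul, h z hz, hDx₀, smul_eq_mul]
          field_simp
          ring
        have hBall : ∀ z, Dz z B = 0 := by
          have hmem := hS₀ B fun z hz => LinearMap.mem_ker.2 (hBS z (Finset.mem_insert_of_mem hz))
          exact fun z => LinearMap.mem_ker.1 (hmem z)
        have hpol : ((Λ.map C + ∑ v, (X v : MvPolynomial ι ℂ) • (A v).map C).adjugate *
            (B.1.map C + ∑ v, (X v : MvPolynomial ι ℂ) • (B.2 v).map C)).trace = 0 :=
          MvPolynomial.funext fun z => by rw [eval_trace_adj_pencil, map_zero, ← hDz]; exact hBall z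
        obtain ⟨P, Q, hP1, hP2⟩ := hT B.1 B.2 hpol
        refine hW (P + (γ / m : ℂ) • 1) (-Q) w hw ?_
        have hw1 : w.1 = B.1 + (γ / m : ℂ) • Λ := by simp [hB]
        have hw2 : ∀ v, w.2 v = B.2 v + (γ / m : ℂ) • A v := fun v => by simp [hB]
        refine Prod.ext ?_ (funext fun v => ?_)
        · rw [hw1, hP1]
          simp only [add_mul, smul_mul_assoc, one_mul, mul_neg, sub_eq_add_neg]
          abel
        · show (P + (γ / m : ℂ) • 1) * A v + A v * -Q = w.2 v
          rw [hw2 v, hP2 v]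
          simp only [add_mul, smul_mul_assoc, one_mul, mul_neg, sub_eq_add_neg]
          abel
    refine ⟨hw0, ?_⟩
    have h0 := h z₀ (Finset.mem_insert_self _ _)
    rw [hw0, map_zero] at h0
    exact (mul_eq_zero.1 h0.symm).resolve_right hz₀
  -- (4) the map `Ψ (c, w) = (det((x₀ + w)(z)) - c f(z))_{z ∈ S}` on `ℂ × W` and its derivative at `(1, 0)`
  let incl : ℂ × W →L[ℂ] (Matrix (Fin m) (Fin m) ℂ × (ι → Matrix (Fin m) (Fin m) ℂ)) :=
    W.subtypeL.comp (ContinuousLinearMap.snd ℂ ℂ W)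
  have hAz : ∀ z : ι → ℂ, HasFDerivAt
      (fun cw : ℂ × W => ev z ((Λ, A) + (cw.2 : Matrix (Fin m) (Fin m) ℂ × (ι → Matrix (Fin m) (Fin m) ℂ))))
      ((LinearMap.toContinuousLinearMap (ev z)).comp incl) (1, 0) := by
    intro z
    have heq : (fun cw : ℂ × W =>
        ev z ((Λ, A) + (cw.2 : Matrix (Fin m) (Fin m) ℂ × (ι → Matrix (Fin m) (Fin m) ℂ)))) =
        fun cw => ev z (Λ, A) + ((LinearMap.toContinuousLinearMap (ev z)).comp incl) cw := by
      funext cw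
      simp [incl, map_add]
    rw [heq]
    exact (ContinuousLinearMap.hasFDerivAt _).const_add _
  choose D hD hDv using fun z : ι → ℂ => hasFDerivAt_det_of_hasFDerivAt (hAz z)
  have hDapply : ∀ z (γ : ℂ) (w : W),
      D z (γ, w) = Dz z (w : Matrix (Fin m) (Fin m) ℂ × (ι → Matrix (Fin m) (Fin m) ℂ)) := by
    intro z γ w
    have e1 : ((Λ, A) : Matrix (Fin m) (Fin m) ℂ × (ι → Matrix (Fin m) (Fin m) ℂ)) +
        ((((1 : ℂ), (0 : W)) : ℂ × W).2 : Matrix (Fin m) (Fin m) ℂ × (ι → Matrix (Fin m) (Fin m) ℂ)) = (Λ, A) := by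
      simp
    rw [hDv, hDz', e1]
    rfl
  have hφ : ∀ s : S, ∃ L : ℂ × W →L[ℂ] ℂ,
      HasFDerivAt (fun cw : ℂ × W => (ev (s : ι → ℂ) ((Λ, A) +
          (cw.2 : Matrix (Fin m) (Fin m) ℂ × (ι → Matrix (Fin m) (Fin m) ℂ)))).det - cw.1 * eval (s : ι → ℂ) f)
        L (1, 0) ∧
      ∀ (γ : ℂ) (w : W), L (γ, w) =
        Dz (s : ι → ℂ) (w : Matrix (Fin m) (Fin m) ℂ × (ι → Matrix (Fin m) (Fin m) ℂ)) - γ * eval (s : ι → ℂ) f := by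
    intro s
    refine ⟨_, (hD (s : ι → ℂ)).fun_sub
      ((ContinuousLinearMap.fst ℂ ℂ W).hasFDerivAt.mul_const (eval (s : ι → ℂ) f)), fun γ w => ?_⟩
    show D (s : ι → ℂ) (γ, w) - (eval (s : ι → ℂ) f) • (ContinuousLinearMap.fst ℂ ℂ W) (γ, w) = _
    rw [hDapply]
    show _ - (eval (s : ι → ℂ) f) • γ = _
    rw [smul_eq_mul, mul_comm]
  choose L₀ hL₀ hL₀v using hφ
  have hΨ : HasFDerivAt
      (fun (cw : ℂ × W) (s : S) => (ev (s : ι → ℂ) ((Λ, A) +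
          (cw.2 : Matrix (Fin m) (Fin m) ℂ × (ι → Matrix (Fin m) (Fin m) ℂ)))).det - cw.1 * eval (s : ι → ℂ) f)
      (ContinuousLinearMap.pi L₀) (1, 0) :=
    hasFDerivAt_pi.2 hL₀
  -- (5) the differential is injective, so `Ψ` is locally injective at `(1, 0)`
  have hker : LinearMap.ker ((ContinuousLinearMap.pi L₀ : ℂ × W →L[ℂ] (S → ℂ)) : ℂ × W →ₗ[ℂ] (S → ℂ)) = ⊥ := by
    refine LinearMap.ker_eq_bot'.2 fun cw hcw => ?_
    obtain ⟨γ, w⟩ := cw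
    have h : ∀ z ∈ S, Dz z (w : Matrix (Fin m) (Fin m) ℂ × (ι → Matrix (Fin m) (Fin m) ℂ)) = γ * eval z f := by
      intro z hz
      have hz' := congrFun hcw ⟨z, hz⟩
      simp only [ContinuousLinearMap.coe_coe, ContinuousLinearMap.pi_apply, Pi.zero_apply, hL₀v] at hz'
      exact sub_eq_zero.1 hz'
    obtain ⟨hw0, hγ0⟩ := hkey γ w w.2 h
    rw [hγ0, (Submodule.coe_eq_zero.1 hw0 : w = 0)]
    rfl
  have hEv := eventually_eq_of_hasFDerivAt_of_ker_eq_bot hΨ hker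
  -- (6) transfer from `ℂ × W` to `ℂ × X` (a metric ball of the same radius)
  obtain ⟨ε, hε, hball⟩ := Metric.eventually_nhds_iff.1 hEv
  refine ⟨Metric.ball ((1 : ℂ), (0 : Matrix (Fin m) (Fin m) ℂ × (ι → Matrix (Fin m) (Fin m) ℂ))) ε,
    Metric.ball_mem_nhds _ hε, fun cw hcw hcW hdet' => ?_⟩
  have hdist : dist ((cw.1, ⟨cw.2, hcW⟩) : ℂ × W) (1, 0) < ε := by
    rw [Metric.mem_ball] at hcw
    calc dist ((cw.1, ⟨cw.2, hcW⟩) : ℂ × W) (1, 0) = dist cw (1, 0) := by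
          simp [Prod.dist_eq]
      _ < ε := hcw
  have h1 := hball hdist
  have h2 : (fun s : S => (ev (s : ι → ℂ) ((Λ, A) +
      ((⟨cw.2, hcW⟩ : W) : Matrix (Fin m) (Fin m) ℂ × (ι → Matrix (Fin m) (Fin m) ℂ)))).det -
        cw.1 * eval (s : ι → ℂ) f) =
      fun s : S => (ev (s : ι → ℂ) ((Λ, A) +
        ((((1 : ℂ), (0 : W)) : ℂ × W).2 : Matrix (Fin m) (Fin m) ℂ × (ι → Matrix (Fin m) (Fin m) ℂ)))).det -
          (((1 : ℂ), (0 : W)) : ℂ × W).1 * eval (s : ι → ℂ) f := by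
    funext s
    have hl : (ev (s : ι → ℂ) ((Λ, A) + cw.2)).det = cw.1 * eval (s : ι → ℂ) f := by
      have := congrArg (eval (s : ι → ℂ)) hdet'
      rw [eval_det_pencil, map_mul, eval_C] at this
      rw [hev]
      exact this
    simp only [ZeroMemClass.coe_zero, add_zero, hdetz, one_mul, sub_self]
    rw [hl, sub_self]
  have h3 := h1 h2
  have h4 := congrArg (fun x : ℂ × W => (x.2 : Matrix (Fin m) (Fin m) ℂ × (ι → Matrix (Fin m) (Fin m) ℂ))) h3
  simpa using h4

end Main

end Summit.ValiantsHypothesis.ValiantsHypothesis.Theorems.RigidityForcesSymmetryRigidMinimalRepr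

end
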